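import Summits.Ventures.GridStability.Models.WSCC9
import Summits.Ventures.GridStability.Models.PolynomialiseRel

/-!
# Equilibrium angles from rational circle points (discharging `RecastData.EqData`) — WSCC9 corollaries

Venture GRIDFUSION, cell `run/shared/lean/pub/gridfusion/`, PARTITION A1 (seat gridfusion-model-1).

The recast files (`Polynomialise.lean`, `PolynomialiseRel.lean`, `PolynomialiseInfBus.lean`) carry the
A1 faithfulness hypothesis `d.EqData δs` — «the rational unit-circle points `(s_i, c_i)` ARE the sines and
cosines of the equilibrium relative angles `δs_i − δs_0`». For exact data with `s_0 = 0`, `c_0 = 1` and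
`s_i² + c_i² = 1` this hypothesis is DISCHARGED by choosing the angles
`angleOf d i := ± arccos c_i` (sign of `s_i`): `RecastData.eqData_angleOf`. Consequently the chain rule
along solutions holds with NO side hypotheses for the instance of record «WSCC9-postB-SPdamp-h12»
(`WSCC9.hasDerivWithinAt_embed`) and for the relative-speed companions (`WSCC9.hasDerivWithinAt_embedRel`)
— inputs (4)–(5) of `Lyapunov/CertificateSoundness.lean` for G1.WSCC9-roa, exactly as
`SMIBInstances.lean` did for G1.SMIB-roa. MODELLED/CERTIFIED: nothing new; no stability claim.
-/

noncomputable section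

open Real
open Literature.Computation.Certificates
open Literature.Computation.Certificates.SOS

namespace Summit.Ventures.GridStability.Models

namespace RecastData

variable {n : ℕ} (d : RecastData n)

/-- The equilibrium relative angles determined by the rational circle points:
`θ_i = arccos c_i` if `s_i ≥ 0`, else `−arccos c_i` (so `sin θ_i = s_i`, `cos θ_i = c_i`). -/
def angleOf (i : Fin (n + 1)) : ℝ :=
  if 0 ≤ d.s i then arccos (d.c i : ℝ) else -arccos (d.c i : ℝ)

/-- `cos (angleOf d i) = c_i` whenever `s_i² + c_i² = 1`. -/
theorem cos_angleOf {i : Fin (n + 1)} (h : d.s i ^ 2 + d.c i ^ 2 = 1) :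
    cos (d.angleOf i) = (d.c i : ℝ) := by
  have h' : ((d.s i : ℝ)) ^ 2 + ((d.c i : ℝ)) ^ 2 = 1 := by exact_mod_cast h
  have hc1 : (-1 : ℝ) ≤ (d.c i : ℝ) := by nlinarith [sq_nonneg ((d.s i : ℝ)), sq_nonneg ((d.c i : ℝ) + 1)]
  have hc2 : (d.c i : ℝ) ≤ 1 := by nlinarith [sq_nonneg ((d.s i : ℝ)), sq_nonneg ((d.c i : ℝ) - 1)]
  unfold angleOf
  split_ifs <;> simp [cos_arccos hc1 hc2]

/-- `sin (angleOf d i) = s_i` whenever `s_i² + c_i² = 1`. -/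
theorem sin_angleOf {i : Fin (n + 1)} (h : d.s i ^ 2 + d.c i ^ 2 = 1) :
    sin (d.angleOf i) = (d.s i : ℝ) := by
  have h' : ((d.s i : ℝ)) ^ 2 + ((d.c i : ℝ)) ^ 2 = 1 := by exact_mod_cast h
  have hsq : (1 : ℝ) - (d.c i : ℝ) ^ 2 = (d.s i : ℝ) ^ 2 := by linarith
  unfold angleOf
  split_ifs with hs
  · rw [sin_arccos, hsq, sqrt_sq (by exact_mod_cast hs)]
  · rw [sin_neg, sin_arccos, hsq]
    have hs' : (d.s i : ℝ) < 0 := by exact_mod_cast lt_of_not_ge hs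
    rw [show (d.s i : ℝ) ^ 2 = (-(d.s i : ℝ)) ^ 2 by ring, sqrt_sq (by linarith)]
    ring

/-- **`EqData` discharged**: if the data carry exact circle points with `s_0 = 0`, `c_0 = 1`, then the
angles `angleOf d` satisfy the A1 faithfulness hypotheses `s_i = sin(θ_i − θ_0)`, `c_i = cos(θ_i − θ_0)`. -/
theorem eqData_angleOf (hcirc : ∀ i, d.s i ^ 2 + d.c i ^ 2 = 1) (hs0 : d.s 0 = 0) (hc0 : d.c 0 = 1) :
    d.EqData (d.angleOf) := by
  have h0 : d.angleOf 0 = 0 := by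
    unfold angleOf
    simp [hs0, hc0]
  refine ⟨fun i => ?_, fun i => ?_⟩
  · rw [h0, sub_zero, d.sin_angleOf (hcirc i)]
  · rw [h0, sub_zero, d.cos_angleOf (hcirc i)]

end RecastData

namespace WSCC9

/-- The A1 hypotheses hold for the instance of record with the angles `angleOf`. -/
theorem postB_SPdamp_eqData : postB_SPdamp.EqData postB_SPdamp.angleOf :=
  postB_SPdamp.eqData_angleOf postB_SPdamp_circle.1 postB_SPdamp_circle.2.1 postB_SPdamp_circle.2.2

/-- The A1 hypotheses hold for the relative-speed companion data. -/
theorem postB_rel_eqData : postB_rel.EqData postB_rel.angleOf :=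
  postB_rel.eqData_angleOf postB_rel_circle.1 postB_rel_circle.2.1 postB_rel_circle.2.2

/-- All inertia coefficients of the instance are nonzero. -/
theorem postB_SPdamp_M_ne_zero : ∀ i, postB_SPdamp.M i ≠ 0 := by decide +kernel

/-- All inertia coefficients of the companion data are nonzero. -/
theorem postB_rel_M_ne_zero : ∀ i, postB_rel.M i ≠ 0 := by decide +kernel

/-- **Hypothesis-free chain rule for «WSCC9-postB-SPdamp-h12».** Along every solution `c` of the model
`postB_SPdamp.toModel` (classical WSCC9, post-B network, S&P damping, speeds relative to `ω_R + ω∞′`)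
on `s`, EVERY recast coordinate `z_k = embed θ^* (c τ) k` satisfies `dz_k/dt = f_k(z)` within `s`,
`f = postB_SPdamp.polyField` — input (4)–(5) material of `Lyapunov/CertificateSoundness.lean`. -/
theorem hasDerivWithinAt_embed {c : ℝ → ClassicalSwing.State 3} {s : Set ℝ}
    (hc : postB_SPdamp.toModel.IsSolutionOn c s) {t : ℝ} (ht : t ∈ s) (k : ℕ) :
    HasDerivWithinAt (fun τ => RecastData.embed postB_SPdamp.angleOf (c τ) k)
      ((postB_SPdamp.polyField.getD k []).eval (RecastData.embed postB_SPdamp.angleOf (c t))) s t :=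
  postB_SPdamp.hasDerivWithinAt_embed postB_SPdamp_eqData postB_SPdamp_M_ne_zero hc ht k

/-- **Hypothesis-free chain rule for the relative-speed companions** «WSCC9-postB-D0-h12» (`λ = 0`) /
«WSCC9-postB-lambda-h12» (`λ = 1/10`), for any common acceleration `a′`. -/
theorem hasDerivWithinAt_embedRel (lam : ℚ) (a : ℝ) {c : ℝ → ClassicalSwing.State 3} {s : Set ℝ}
    (hc : (postB_rel.toModelRel lam a).IsSolutionOn c s) {t : ℝ} (ht : t ∈ s) (k : ℕ) :
    HasDerivWithinAt (fun τ => RecastData.embedRel postB_rel.angleOf (c τ) k)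
      (((postB_rel.relField lam).getD k []).eval (RecastData.embedRel postB_rel.angleOf (c t))) s t :=
  postB_rel.hasDerivWithinAt_embedRel lam postB_rel_eqData postB_rel_M_ne_zero a hc ht k

/-- The recast constraints hold identically along the embedding (input (5)). -/
theorem eval_hcon (x : ClassicalSwing.State 3) (i : Fin 2) :
    (RecastData.hcon i).eval (RecastData.embed postB_SPdamp.angleOf x) = 0 :=
  RecastData.eval_hcon (δs := postB_SPdamp.angleOf) x i

end WSCC9

end Summit.Ventures.GridStability.Models
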